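import Literature.NumberTheory.EllipticCurves.Kato2004.OrdinaryKernelFunctionalOfPoitouTateProofs
import HarnessLib

/-!
# VET (w3 g10, evidence for the LEAD lineage cruxlead-19573 / crux-triage 19573): the skeleton's two cite stubs of the F1 slot RE-CUT

Skeleton v24 (`Lines/steinberg_fibre_at_two.lean`) carries `stub_tateDualityTower : exists_lambdaAdicLocalTatePairing_selmer_orthogonal` and
`stub_ordKernelFunctional : exists_ordinaryKernelFunctional` (both `sorry`, cite tier).  After this seat's p746128
(`Kato2004.exists_ordinaryKernelFunctional_of_poitouTate_of_ordinaryQuotientRank`) the SAME two obligations are DERIVED from two cite stubs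
that are both D-audited print facts (audit-2 sheets hPTE PASS, hOQR1 PASS):
`stub_PT : exists_lambdaAdicLocalTatePairing_poitouTate_exact` (p729889) and `stub_Q : localIwasawaH1_ordinaryQuotient_isTorsionFree_rank_eq_one`
(p740652) — and the XL print fact (12.2.3) `localIwasawaH1_tateRep_moduleFinite` is no longer on the price sheet of the line.
This file only CHECKS that the re-cut elaborates (2 sorries = the two cite stubs; nothing else).  The LEAD decides whether to adopt it.
-/

set_option linter.dupNamespace false

namespace Summit.BirchSwinnertonDyer.BirchSwinnertonDyer.Cruxes.OrdKatoHalfAtTwoIso.VetRekeyW3g10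

open Literature.NumberTheory.EllipticCurves.Kato2004

/-- cite stub (PRINT-COMPOSITE, audit hPTE PASS): Poitou–Tate exactness on Kato's pinned carriers, p729889. -/
theorem stub_PT : exists_lambdaAdicLocalTatePairing_poitouTate_exact := by
  sorry

/-- cite stub (PRINT, audit hOQR1 PASS): the ordinary quotient is torsion-free of rank one, p740652. -/
theorem stub_Q : localIwasawaH1_ordinaryQuotient_isTorsionFree_rank_eq_one := by
  sorry

/-- DERIVED (was `stub_tateDualityTower`, sorry): the projection of p729889 (w3 g6 p729924). -/
theorem stub_tateDualityTower : exists_lambdaAdicLocalTatePairing_selmer_orthogonal :=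
  exists_lambdaAdicLocalTatePairing_selmer_orthogonal_of_poitouTate_exact stub_PT

/-- DERIVED (was `stub_ordKernelFunctional`, sorry): this seat's p746128 — (12.2.3) NOT needed. -/
theorem stub_ordKernelFunctional : exists_ordinaryKernelFunctional :=
  exists_ordinaryKernelFunctional_of_poitouTate_of_ordinaryQuotientRank stub_PT stub_Q

end Summit.BirchSwinnertonDyer.BirchSwinnertonDyer.Cruxes.OrdKatoHalfAtTwoIso.VetRekeyW3g10
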